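import Summits.BirchSwinnertonDyer.BirchSwinnertonDyer.Theorems.PrintCf2SplitBadTwoRestrictedSelmerConjTransport
import Summits.BirchSwinnertonDyer.BirchSwinnertonDyer.Theorems.PrintCf2SplitBadTwoRestrictedSelmerConjTransportPlaces
import Summits.BirchSwinnertonDyer.BirchSwinnertonDyer.Theorems.PrintCf2SplitBadTwoCMPrimaryConjugationTransport
import Summits.BirchSwinnertonDyer.BirchSwinnertonDyer.Theorems.PrintCf2SplitBadTwoLineNoSplitPrimes
import Literature.NumberTheory.EllipticCurves.SelmerPInftyGaloisAction
import Literature.NumberTheory.EllipticCurves.KummerSelmerStructure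
import HarnessLib

/-!
# Crux `PrintCf2.SplitBadTwoRankOneOfFacts` (stmt-BirchSwinnertonDyer-20368), road α v10.3 — brick (CT-𝔖), file 3:
# **hfinB ↔ hfinB′**: `𝔖_{v̄}(K, E[𝔮_r^∞])` and `𝔖_v(K, E[𝔮_{1−r}^∞])` correspond under a lift of complex conjugation

Cell `bsd-print-cf2`, width seat `bsd-line-cf2-p1-w2` g10 (prover-bsd-line-cf2-p1-w2-g10-0); `--supports
stmt-BirchSwinnertonDyer-20368` (helper, Theses-free). HONEST FRAMING: nothing here closes a crux or a stub; BSD is not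
proved by any of this; no summit statement is proved by this seat. THEOREMS ONLY (no definition, no named fact, no
`sorry`, no instance).

WHAT. `W/ℚ` elliptic, `K` imaginary quadratic with `2 = v·v̄` (`v̄ ≠ v`), `π ∈ End_K(E_K)` with `π² = π − 2`, `r ∈ ℤ₂` arbitrary,
`W* = E[𝔮_r^∞] = (W.baseChange K).endEigenPrimaryTorsion 2 π r`, `W*′ = E[𝔮_{1−r}^∞]`. Then
**`Finite 𝔖_{v̄}(K, W*) ↔ Finite 𝔖_v(K, W*′)`** and **`Nat.card 𝔖_{v̄}(K, W*) = Nat.card 𝔖_v(K, W*′)`**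
(`finite_restrictedSelmerBase_conj_iff`, `natCard_restrictedSelmerBase_conj`; the S3c-binder form
`finite_restrictedSelmerBase_conj_of_finite` = **hfinB′ ⟸ hfinB**, the displayed input of -w4 g9's (α)/(R-TOP)⟸(LS) lane
`natCard_endCoinvariants_eq_one_of_frame_of_locSurj` and of -w3 g9's (LS-b) `exists_pow_nsmul_map_eq_zero_of_apply_eq_proj`;
`TURNKEY-20368-LS-w4g9.md` §1 Alternative (M) «no tree API found» — files 1–3 are that API).
HOW. -w2 g8's anti-commuting transport lift `τ = e σ₀ e⁻¹` of `σ₀ ∈ Γ_ℚ` (`CMPrimes.exists_transport_anticommute`) lifts an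
automorphism `c` of `K` with `c ≠ 1` (§1: a `K`-LINEAR `τ` would commute with `π`, and anti-commutation would give `2πQ = Q` on
`E[2] ≠ 0`), hence `c·v̄ = v` (-w3 g8 `LineDecomposition.eq_or_eq_smul_of_natCast_mem`); `τ` maps `W*` onto `W*′`
(`CMPrimes.mem_endEigenPrimaryTorsion_one_sub_of_anticommute`) compatibly with `g ↦ τ⁻¹gτ` (§2, ∃-carried `ψ`); file 1
(`ConjTransport.resH1Hom_mem_restrictedSelmerBase`, round trip `resH1Hom_comp_resH1Hom_eq_id`) and file 2 (place clause
`exists_conjGalCMH_decomp_mem_conj_decomp` with `c⁻¹·v = v̄`, complex places) give mutually inverse transports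
`𝔖_{v̄}(K, W*) ⇄ 𝔖_v(K, W*′)` (§3 `transport_restrictedSelmerBase`, for any `c`, lift `τ` with compatible `T, T′` on `\bar ℤ_K`,
strict places `c⁻¹·𝔮′ = 𝔮`, `ρ′ = 1 − ρ`).

References: A. Agboola, Compositio 143 (2007) §3, §6 [Agboola2007]; K. Rubin, LNM 1716 (1999) §2–3; B. H. Gross, LMS LNS 153
(1991) §5 (5.1) [GrossLMS1991]; J. Neukirch, A. Schmidt, K. Wingberg (2008) I §5 [NeukirchSchmidtWingberg2008].
-/

noncomputable section

open scoped Classical Pointwise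

set_option linter.dupNamespace false
set_option autoImplicit false

namespace Summit.BirchSwinnertonDyer.BirchSwinnertonDyer.Theorems.PrintCf2.ConjTransport

open WeierstrassCurve Literature.NumberTheory.EllipticCurves Literature.NumberTheory.EllipticCurves.GreenbergSelmer
open Literature.NumberTheory.EllipticCurves.Agboola2007 Literature.NumberTheory.GaloisRepresentations
open Literature.NumberTheory.Automorphic Field NumberField IsDedekindDomain
open Summit.BirchSwinnertonDyer.BirchSwinnertonDyer.Theorems.PrintCf2.CMPrimes

variable (W : WeierstrassCurve ℚ) [W.IsElliptic] (K : Type) [Field K] [NumberField K]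

/-! ## §1 An anti-commuting lift restricts NON-TRIVIALLY to `K` -/

/-- **A lift `τ` of `c ∈ Aut(K/ℚ)` anti-commuting with a `K`-rational `π` (`π(τQ) = τQ − τ(πQ)`) has `c ≠ 1`.** If `c = 1` then
`τ` is `K`-linear, i.e. an element `g ∈ Γ_K`, which COMMUTES with `π ∈ End_K(E)`; anti-commutation then reads `2·g(πQ) = gQ`,
i.e. `π(2Q) = Q`, and a point `Q ≠ 0` of order `2` (`#E[2] = 4`, tree `natCard_geomTorsion`) gives `Q = π 0 = 0`. For
`K = ℚ(√−7)`, `π = (1+√−7)/2`: `τ|_K` is complex conjugation. [cite: SilvermanATAEC1994, II §2 Thm. 2.2(b)]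
[cite: GrossLMS1991, §5 (5.1)] -/
theorem ne_one_of_isLiftOfAut_of_anticommute {c : K ≃ₐ[ℚ] K} {τ : AlgebraicClosure K ≃+* AlgebraicClosure K}
    (hτ : IsLiftOfAut c τ) (π : (W.baseChange K).endRing)
    (hanti : ∀ Q, (π : AddMonoid.End (W.baseChange K).geomPoints) (hτ.pointsMap W Q) =
      hτ.pointsMap W Q - hτ.pointsMap W ((π : AddMonoid.End (W.baseChange K).geomPoints) Q)) :
    c ≠ 1 := by
  intro hc
  -- `τ` is `K`-linear: an element `g ∈ Γ_K`
  have hlin : ∀ x : K, τ (algebraMap K (AlgebraicClosure K) x) = algebraMap K (AlgebraicClosure K) x := fun x ↦ by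
    rw [hτ x, hc, AlgEquiv.one_apply]
  let g : absoluteGaloisGroup K := AlgEquiv.ofRingEquiv (f := τ) hlin
  have hg : ∀ Q : (W.baseChange K).geomPoints, hτ.pointsMap W Q = g • Q := by
    intro Q
    change ((W.baseChange K).baseChange (AlgebraicClosure K)).toAffine.Point at Q
    rcases Q with _ | ⟨x, y, h⟩
    · rfl
    · exact Affine.Point.some_eq_some_of_eq rfl rfl
  -- `π` commutes with `g`
  have hequiv := ((W.baseChange K).mem_equivariantSubring_iff (π : AddMonoid.End (W.baseChange K).geomPoints)).1
    (Subring.mem_inf.1 π.2).2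
  -- a point of order `2`
  have hcard : Nat.card ↥(geomTorsion (W.baseChange K) (2 : ℤ)) = 4 := by
    rw [WeierstrassCurve.natCard_geomTorsion (W.baseChange K) 2 two_ne_zero]; rfl
  haveI : Finite ↥(geomTorsion (W.baseChange K) (2 : ℤ)) := Nat.finite_of_card_ne_zero (by rw [hcard]; norm_num)
  haveI : Nontrivial ↥(geomTorsion (W.baseChange K) (2 : ℤ)) := by
    rw [← Finite.one_lt_card_iff_nontrivial, hcard]; norm_num
  obtain ⟨T, hT⟩ := exists_ne (0 : ↥(geomTorsion (W.baseChange K) (2 : ℤ)))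
  have hT2 : (2 : ℤ) • (T : (W.baseChange K).geomPoints) = 0 := (mem_geomTorsion_iff _ _ _).1 T.2
  -- anti-commutation at `T`: `g(πT) = gT − g(πT)`
  have key := hanti T
  simp only [hg] at key
  rw [hequiv] at key
  -- `πT + πT = T`
  have h2 : (π : AddMonoid.End (W.baseChange K).geomPoints) T + (π : AddMonoid.End (W.baseChange K).geomPoints) T =
      (T : (W.baseChange K).geomPoints) := by
    apply (smul_left_cancel_iff g).1
    rw [smul_add]
    exact eq_sub_iff_add_eq.mp key
  have h0 : (π : AddMonoid.End (W.baseChange K).geomPoints) T + (π : AddMonoid.End (W.baseChange K).geomPoints) T = 0 := by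
    rw [← map_add, ← two_smul ℤ, hT2, map_zero]
  exact hT (Subtype.ext (h2.symm.trans h0))

/-! ## §2 The semilinear map `τ| : E[𝔮_ρ^∞] → E[𝔮_{1−ρ}^∞]` (∃-carried) -/

omit [W.IsElliptic] in
/-- **`τ` restricts to an additive map `ψ : E[𝔮_ρ^∞] → E[𝔮_{ρ′}^∞]`, `ρ′ = 1 − ρ`, compatible with `g ↦ τ⁻¹gτ`**
(`ψ((τ⁻¹gτ)·x) = g·ψ(x)`, `IsLiftOfAut.pointsMap_smul`), with `ψ x = τ x` on points — from the membership transfer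
`CMPrimes.mem_endEigenPrimaryTorsion_one_sub_of_anticommute` (-w2 g8). ∃-carried, no definition.
[cite: Rubin1999, §2 and Prop. 5.4] [cite: SerreGaloisCohomology1997, I.§2.4 (compatible pairs)] -/
theorem exists_addMonoidHom_endEigenPrimaryTorsion_of_anticommute {c : K ≃ₐ[ℚ] K}
    {τ : AlgebraicClosure K ≃+* AlgebraicClosure K} (hτ : IsLiftOfAut c τ) (π : (W.baseChange K).endRing)
    (hanti : ∀ Q, (π : AddMonoid.End (W.baseChange K).geomPoints) (hτ.pointsMap W Q) =
      hτ.pointsMap W Q - hτ.pointsMap W ((π : AddMonoid.End (W.baseChange K).geomPoints) Q))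
    {ρ ρ' : ℤ_[2]} (hρ : ρ' = 1 - ρ) :
    ∃ ψ : ↥((W.baseChange K).endEigenPrimaryTorsion 2 π ρ) →+ ↥((W.baseChange K).endEigenPrimaryTorsion 2 π ρ'),
      (∀ x : ↥((W.baseChange K).endEigenPrimaryTorsion 2 π ρ),
        (((ψ x : ↥((W.baseChange K).endEigenPrimaryTorsion 2 π ρ')) : ↥((W.baseChange K).geomPrimaryTorsion 2)) :
          (W.baseChange K).geomPoints) = hτ.pointsMap W ((x : ↥((W.baseChange K).geomPrimaryTorsion 2)) : (W.baseChange K).geomPoints)) ∧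
      ∀ (g : absoluteGaloisGroup K) (x : ↥((W.baseChange K).endEigenPrimaryTorsion 2 π ρ)),
        ψ (hτ.conjGalCMH g • x) = g • ψ x := by
  haveI : Fact (Nat.Prime 2) := ⟨Nat.prime_two⟩
  subst hρ
  have hmem : ∀ x : ↥((W.baseChange K).endEigenPrimaryTorsion 2 π ρ),
      hτ.primaryTorsionMap W 2 (x : ↥((W.baseChange K).geomPrimaryTorsion 2)) ∈
        (W.baseChange K).endEigenPrimaryTorsion 2 π (1 - ρ) := fun x ↦
    mem_endEigenPrimaryTorsion_one_sub_of_anticommute W K π (hτ.pointsMap W) (hτ.symm_isLiftOfAut.pointsMap W)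
      (pointsMap_symm_pointsMap W K hτ) hanti x.2 (map_mem_geomPrimaryTorsion W K _ _)
  refine ⟨((hτ.primaryTorsionMap W 2).comp ((W.baseChange K).endEigenPrimaryTorsion 2 π ρ).subtype).codRestrict _
      (fun x ↦ hmem x), fun x ↦ rfl, fun g x ↦ ?_⟩
  apply Subtype.ext
  change hτ.primaryTorsionMap W 2 (hτ.conjGalCMH g • (x : ↥((W.baseChange K).geomPrimaryTorsion 2))) =
    g • hτ.primaryTorsionMap W 2 (x : ↥((W.baseChange K).geomPrimaryTorsion 2))
  exact hτ.primaryTorsionMap_smul W 2 g _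

/-- Round trip of the two lifts on points of the summands: `τ (τ⁻¹ y) = y`. [folklore] -/
theorem conjGalCMH_symm_conjGalCMH {c : K ≃ₐ[ℚ] K} {τ : AlgebraicClosure K ≃+* AlgebraicClosure K} (hτ : IsLiftOfAut c τ)
    (g : absoluteGaloisGroup K) : hτ.conjGalCMH (hτ.symm_isLiftOfAut.conjGalCMH g) = g := by
  apply AlgEquiv.ext
  intro x
  change τ.symm (τ.symm.symm ((show AlgebraicClosure K ≃ₐ[K] AlgebraicClosure K from g) (τ.symm (τ x)))) =
    (show AlgebraicClosure K ≃ₐ[K] AlgebraicClosure K from g) x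
  rw [RingEquiv.symm_symm, RingEquiv.symm_apply_apply, RingEquiv.symm_apply_apply]

/-- Round trip, other order: `τ⁻¹ (τ g τ⁻¹) τ = g`. [folklore] -/
theorem conjGalCMH_conjGalCMH_symm {c : K ≃ₐ[ℚ] K} {τ : AlgebraicClosure K ≃+* AlgebraicClosure K} (hτ : IsLiftOfAut c τ)
    (g : absoluteGaloisGroup K) : hτ.symm_isLiftOfAut.conjGalCMH (hτ.conjGalCMH g) = g := by
  apply AlgEquiv.ext
  intro x
  change τ.symm.symm (τ.symm ((show AlgebraicClosure K ≃ₐ[K] AlgebraicClosure K from g) (τ (τ.symm x)))) =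
    (show AlgebraicClosure K ≃ₐ[K] AlgebraicClosure K from g) x
  rw [RingEquiv.symm_symm, RingEquiv.apply_symm_apply, RingEquiv.apply_symm_apply]

/-! ## §3 The transport `𝔖_𝔮(K, E[𝔮_ρ^∞]) ⇄ 𝔖_{𝔮′}(K, E[𝔮_{ρ′}^∞])` for a lift of `c` with `c⁻¹·𝔮′ = 𝔮` -/

omit [W.IsElliptic] in
/-- **ABSTRACT TRANSPORT THEOREM.** `K` a totally complex number field, `c ∈ Aut(K/ℚ)` with a lift `τ` anti-commuting with
`π ∈ End_K(E_K)` (`π² = π − 2` not needed here) and compatible ring endomorphisms `T, T′` of `\bar ℤ_K` for `τ, τ⁻¹`; places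
`𝔮, 𝔮′` with `c⁻¹·𝔮′ = 𝔮`; `ρ′ = 1 − ρ`. Then the transports along `(τ⁻¹·τ, τ|)` and `(τ·τ⁻¹, τ⁻¹|)` are mutually inverse
and exchange `𝔖_𝔮(K, E[𝔮_ρ^∞])` and `𝔖_{𝔮′}(K, E[𝔮_{ρ′}^∞])`: **the two groups have the same `Nat.card` and are finite together.**
[cite: Agboola2007, §3 (arXiv p0008:L58–68)] [cite: NeukirchSchmidtWingberg2008, I §5 (conjugation on cohomology)] -/
theorem transport_restrictedSelmerBase [IsTotallyComplex K] {c : K ≃ₐ[ℚ] K}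
    {τ : AlgebraicClosure K ≃+* AlgebraicClosure K} (hτ : IsLiftOfAut c τ)
    (T T' : absIntegers (𝓞 K) K →+* absIntegers (𝓞 K) K)
    (hT : ∀ y : absIntegers (𝓞 K) K, ((T y : absIntegers (𝓞 K) K) : AlgebraicClosure K) = τ y)
    (hT' : ∀ y : absIntegers (𝓞 K) K, ((T' y : absIntegers (𝓞 K) K) : AlgebraicClosure K) = τ.symm y)
    (π : (W.baseChange K).endRing)
    (hanti : ∀ Q, (π : AddMonoid.End (W.baseChange K).geomPoints) (hτ.pointsMap W Q) =
      hτ.pointsMap W Q - hτ.pointsMap W ((π : AddMonoid.End (W.baseChange K).geomPoints) Q))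
    {ρ ρ' : ℤ_[2]} (hρ : ρ' = 1 - ρ) {p : ℕ} {𝔮 𝔮' : HeightOneSpectrum (𝓞 K)} (h𝔮 : c⁻¹ • 𝔮' = 𝔮) :
    Nat.card ↥(restrictedSelmerBase ↥((W.baseChange K).endEigenPrimaryTorsion 2 π ρ) p 𝔮) =
        Nat.card ↥(restrictedSelmerBase ↥((W.baseChange K).endEigenPrimaryTorsion 2 π ρ') p 𝔮') ∧
      (Finite ↥(restrictedSelmerBase ↥((W.baseChange K).endEigenPrimaryTorsion 2 π ρ) p 𝔮) ↔
        Finite ↥(restrictedSelmerBase ↥((W.baseChange K).endEigenPrimaryTorsion 2 π ρ') p 𝔮')) := by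
  -- the inverse lift and its data
  have hτ' := hτ.symm_isLiftOfAut
  have hanti' := pointsMap_symm_anticommute W K hτ hanti
  have hρ' : ρ = 1 - ρ' := by rw [hρ, sub_sub_cancel]
  have h𝔮' : c.symm⁻¹ • 𝔮 = 𝔮' := by
    rw [← AlgEquiv.aut_inv, inv_inv, ← h𝔮, smul_inv_smul]
  -- the two continuous endomorphisms of `⊤ ≤ Γ_K`
  obtain ⟨Φ₁, hΦ₁⟩ := exists_topHom hτ.conjGalCMH
  obtain ⟨Φ₂, hΦ₂⟩ := exists_topHom hτ'.conjGalCMH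
  -- the two semilinear maps on the summands
  obtain ⟨ψ₁, hψ₁, hψ₁s⟩ := exists_addMonoidHom_endEigenPrimaryTorsion_of_anticommute W K hτ π hanti hρ
  obtain ⟨ψ₂, hψ₂, hψ₂s⟩ := exists_addMonoidHom_endEigenPrimaryTorsion_of_anticommute W K hτ' π hanti' hρ'
  -- compatibilities
  have h₁ : ∀ (x : (⊤ : Subgroup (absoluteGaloisGroup K))) (m : ↥((W.baseChange K).endEigenPrimaryTorsion 2 π ρ)),
      ψ₁ (Φ₁ x • m) = x • ψ₁ m := fun x m ↦ by
    change ψ₁ (((Φ₁ x : (⊤ : Subgroup (absoluteGaloisGroup K))) : absoluteGaloisGroup K) • m) =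
      (x : absoluteGaloisGroup K) • ψ₁ m
    rw [hΦ₁]; exact hψ₁s _ m
  have h₂ : ∀ (x : (⊤ : Subgroup (absoluteGaloisGroup K))) (m : ↥((W.baseChange K).endEigenPrimaryTorsion 2 π ρ')),
      ψ₂ (Φ₂ x • m) = x • ψ₂ m := fun x m ↦ by
    change ψ₂ (((Φ₂ x : (⊤ : Subgroup (absoluteGaloisGroup K))) : absoluteGaloisGroup K) • m) =
      (x : absoluteGaloisGroup K) • ψ₂ m
    rw [hΦ₂]; exact hψ₂s _ m
  have hΦ₂₁ : ∀ x : (⊤ : Subgroup (absoluteGaloisGroup K)), Φ₂ (Φ₁ x) = x := fun x ↦ by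
    apply Subtype.ext; rw [hΦ₂, hΦ₁]; exact conjGalCMH_conjGalCMH_symm K hτ _
  have hΦ₁₂ : ∀ x : (⊤ : Subgroup (absoluteGaloisGroup K)), Φ₁ (Φ₂ x) = x := fun x ↦ by
    apply Subtype.ext; rw [hΦ₁, hΦ₂]; exact conjGalCMH_symm_conjGalCMH K hτ _
  have hψ₁₂ : ∀ m, ψ₁ (ψ₂ m) = m := fun m ↦ by
    apply Subtype.ext; apply Subtype.ext
    rw [hψ₁, hψ₂]; exact pointsMap_pointsMap_symm W K hτ _
  have hψ₂₁ : ∀ m, ψ₂ (ψ₁ m) = m := fun m ↦ by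
    apply Subtype.ext; apply Subtype.ext
    rw [hψ₂, hψ₁]; exact pointsMap_symm_pointsMap W K hτ _
  -- injectivity of both transports
  have hinj₁ := resH1Hom_injective_of_inverse Φ₂ Φ₁ ψ₂ ψ₁ h₂ h₁ hΦ₁₂ hψ₂₁
  have hinj₂ := resH1Hom_injective_of_inverse Φ₁ Φ₂ ψ₁ ψ₂ h₁ h₂ hΦ₂₁ hψ₁₂
  -- both transports preserve the restricted Selmer groups
  have hmaps₁ : ∀ a ∈ restrictedSelmerBase ↥((W.baseChange K).endEigenPrimaryTorsion 2 π ρ) p 𝔮,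
      resH1Hom Φ₁ ψ₁ h₁ a ∈ restrictedSelmerBase ↥((W.baseChange K).endEigenPrimaryTorsion 2 π ρ') p 𝔮' := by
    intro a ha
    refine resH1Hom_mem_restrictedSelmerBase Φ₁ ψ₁ h₁ (fun u ↦ ?_) ?_ (fun w ↦ ?_) ha
    · obtain ⟨t, ht⟩ := exists_conjGalCMH_decomp_mem_conj_decomp hτ T hT u
      exact ⟨c⁻¹ • u, t, (natCast_mem_inv_smul_asIdeal_iff p u).1, fun x hx ↦ by rw [hΦ₁]; exact ht _ hx⟩
    · obtain ⟨t, ht⟩ := exists_conjGalCMH_decomp_mem_conj_decomp hτ T hT 𝔮'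
      rw [h𝔮] at ht
      exact ⟨t, fun x hx ↦ by rw [hΦ₁]; exact ht _ hx⟩
    · obtain ⟨w', t, ht⟩ := exists_conjGalCMH_decompInf_mem hτ w
      exact ⟨w', t, fun x hx ↦ by rw [hΦ₁]; exact ht _ hx⟩
  have hmaps₂ : ∀ a ∈ restrictedSelmerBase ↥((W.baseChange K).endEigenPrimaryTorsion 2 π ρ') p 𝔮',
      resH1Hom Φ₂ ψ₂ h₂ a ∈ restrictedSelmerBase ↥((W.baseChange K).endEigenPrimaryTorsion 2 π ρ) p 𝔮 := by
    intro a ha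
    refine resH1Hom_mem_restrictedSelmerBase Φ₂ ψ₂ h₂ (fun u ↦ ?_) ?_ (fun w ↦ ?_) ha
    · obtain ⟨t, ht⟩ := exists_conjGalCMH_decomp_mem_conj_decomp hτ' T' hT' u
      exact ⟨c.symm⁻¹ • u, t, (natCast_mem_inv_smul_asIdeal_iff p u).1, fun x hx ↦ by rw [hΦ₂]; exact ht _ hx⟩
    · obtain ⟨t, ht⟩ := exists_conjGalCMH_decomp_mem_conj_decomp hτ' T' hT' 𝔮
      rw [h𝔮'] at ht
      exact ⟨t, fun x hx ↦ by rw [hΦ₂]; exact ht _ hx⟩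
    · obtain ⟨w', t, ht⟩ := exists_conjGalCMH_decompInf_mem hτ' w
      exact ⟨w', t, fun x hx ↦ by rw [hΦ₂]; exact ht _ hx⟩
  refine ⟨natCard_eq_of_injective_of_mapsTo _ _ hinj₁ hinj₂ hmaps₁ hmaps₂, ?_, ?_⟩
  · exact fun h ↦ finite_of_injective_of_mapsTo _ hinj₂ hmaps₂ h
  · exact fun h ↦ finite_of_injective_of_mapsTo _ hinj₁ hmaps₁ h

/-! ## §4 The frame: `K` imaginary quadratic, `2 = v·v̄`, `π² = π − 2` -/

/-- **hfinB ↔ hfinB′ on the S3c frame (and equal cardinalities).** `W/ℚ` elliptic, `K` imaginary quadratic, `2 ∈ v, v̄`,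
`v̄ ≠ v`, `π ∈ End_K(E_K)` with `π² = π − 2`, `r ∈ ℤ₂`: `Nat.card 𝔖_{v̄}(K, E[𝔮_r^∞]) = Nat.card 𝔖_v(K, E[𝔮_{1−r}^∞])` and
`Finite 𝔖_{v̄}(K, E[𝔮_r^∞]) ↔ Finite 𝔖_v(K, E[𝔮_{1−r}^∞])`. Proof: the anti-commuting transport lift `τ`
(`CMPrimes.exists_transport_anticommute`) lifts `c ≠ 1` (§1), so `c·v̄ = v` (`LineDecomposition.eq_or_eq_smul_of_natCast_mem`),
i.e. `c⁻¹·v = v̄`; apply §3. [cite: Agboola2007, §3 and §6 (the restricted Selmer groups over K)] [cite: GrossLMS1991, §5 (5.1)] -/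
theorem natCard_and_finite_restrictedSelmerBase_conj (hK : IsImaginaryQuadratic K) {v vbar : HeightOneSpectrum (𝓞 K)}
    (hv : ((2 : ℕ) : 𝓞 K) ∈ v.asIdeal) (hvbar : ((2 : ℕ) : 𝓞 K) ∈ vbar.asIdeal) (hne : vbar ≠ v)
    (π : (W.baseChange K).endRing) (hrel : (π : AddMonoid.End (W.baseChange K).geomPoints) * π = π - 2) (r : ℤ_[2]) :
    Nat.card ↥(restrictedSelmerBase ↥((W.baseChange K).endEigenPrimaryTorsion 2 π r) 2 vbar) =
        Nat.card ↥(restrictedSelmerBase ↥((W.baseChange K).endEigenPrimaryTorsion 2 π (1 - r)) 2 v) ∧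
      (Finite ↥(restrictedSelmerBase ↥((W.baseChange K).endEigenPrimaryTorsion 2 π r) 2 vbar) ↔
        Finite ↥(restrictedSelmerBase ↥((W.baseChange K).endEigenPrimaryTorsion 2 π (1 - r)) 2 v)) := by
  haveI : Algebra.IsQuadraticExtension ℚ K := ⟨hK.1⟩
  haveI : IsGalois ℚ K := inferInstance
  haveI : IsTotallyComplex K := hK.2
  obtain ⟨σ₀, hτ, hanti⟩ := exists_transport_anticommute W K π hrel
  have hc : (absGaloisTransportRat K σ₀).restrictNormal K ≠ 1 := ne_one_of_isLiftOfAut_of_anticommute W K hτ π hanti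
  have hcv : (absGaloisTransportRat K σ₀).restrictNormal K • vbar = v :=
    (LineDecomposition.eq_or_eq_smul_of_natCast_mem hK.1 hc Nat.prime_two hv hvbar hne).2.1
  have h𝔮 : ((absGaloisTransportRat K σ₀).restrictNormal K)⁻¹ • v = vbar := by
    rw [inv_smul_eq_iff, hcv]
  obtain ⟨T, hT⟩ := exists_ringHom_coe_eq_absGaloisTransport (K := K) σ₀
  obtain ⟨T', hT'⟩ := exists_ringHom_coe_eq_absGaloisTransport_symm (K := K) σ₀
  exact transport_restrictedSelmerBase W K hτ T T' hT hT' π hanti (ρ := r) (ρ' := 1 - r) rfl h𝔮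

/-- **`Nat.card 𝔖_{v̄}(K, W*) = Nat.card 𝔖_v(K, W*′)`** on the S3c frame (`W* = E[𝔮_r^∞]`, `W*′ = E[𝔮_{1−r}^∞]`).
[cite: Agboola2007, §6 (restricted Selmer groups over K)] -/
theorem natCard_restrictedSelmerBase_conj (hK : IsImaginaryQuadratic K) {v vbar : HeightOneSpectrum (𝓞 K)}
    (hv : ((2 : ℕ) : 𝓞 K) ∈ v.asIdeal) (hvbar : ((2 : ℕ) : 𝓞 K) ∈ vbar.asIdeal) (hne : vbar ≠ v)
    (π : (W.baseChange K).endRing) (hrel : (π : AddMonoid.End (W.baseChange K).geomPoints) * π = π - 2) (r : ℤ_[2]) :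
    Nat.card ↥(restrictedSelmerBase ↥((W.baseChange K).endEigenPrimaryTorsion 2 π r) 2 vbar) =
      Nat.card ↥(restrictedSelmerBase ↥((W.baseChange K).endEigenPrimaryTorsion 2 π (1 - r)) 2 v) :=
  (natCard_and_finite_restrictedSelmerBase_conj W K hK hv hvbar hne π hrel r).1

/-- **`Finite 𝔖_{v̄}(K, W*) ↔ Finite 𝔖_v(K, W*′)`** on the S3c frame. [cite: Agboola2007, §6 (restricted Selmer groups over K)] -/
theorem finite_restrictedSelmerBase_conj_iff (hK : IsImaginaryQuadratic K) {v vbar : HeightOneSpectrum (𝓞 K)}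
    (hv : ((2 : ℕ) : 𝓞 K) ∈ v.asIdeal) (hvbar : ((2 : ℕ) : 𝓞 K) ∈ vbar.asIdeal) (hne : vbar ≠ v)
    (π : (W.baseChange K).endRing) (hrel : (π : AddMonoid.End (W.baseChange K).geomPoints) * π = π - 2) (r : ℤ_[2]) :
    Finite ↥(restrictedSelmerBase ↥((W.baseChange K).endEigenPrimaryTorsion 2 π r) 2 vbar) ↔
      Finite ↥(restrictedSelmerBase ↥((W.baseChange K).endEigenPrimaryTorsion 2 π (1 - r)) 2 v) :=
  (natCard_and_finite_restrictedSelmerBase_conj W K hK hv hvbar hne π hrel r).2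

/-- **hfinB′ ⟸ hfinB, in the S3c binder currency** (the displayed input of -w4 g9's
`natCard_endCoinvariants_eq_one_of_frame_of_locSurj` / `…RestrictedSelmerH2Vanishing` (α) and of -w3 g9's (LS-b)
`exists_pow_nsmul_map_eq_zero_of_apply_eq_proj`): on every frame `(K, v, v̄, π, r)` of `stub_restrictedControl_two`,
`Finite (restrictedSelmerBase W* 2 v̄) → Finite (restrictedSelmerBase ↥(endEigenPrimaryTorsion 2 π (1 − r)) 2 v)`. The unused
frame binders (`d`, `C • W = cm7^{(d)}`, `r² = r − 2`, the pinning clause) are not needed and not taken.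
[cite: Agboola2007, §6 Prop. 6.10–6.11 (finiteness of the restricted Selmer group over K)] -/
theorem finite_restrictedSelmerBase_conj_of_finite (hK : IsImaginaryQuadratic K) (v vbar : HeightOneSpectrum (𝓞 K))
    (hv : ((2 : ℕ) : 𝓞 K) ∈ v.asIdeal) (hvbar : ((2 : ℕ) : 𝓞 K) ∈ vbar.asIdeal) (hne : vbar ≠ v)
    (π : (W.baseChange K).endRing) (hrel : (π : AddMonoid.End (W.baseChange K).geomPoints) * π = π - 2) (r : ℤ_[2])
    (hfinB : Finite ↥(restrictedSelmerBase ↥((W.baseChange K).endEigenPrimaryTorsion 2 π r) 2 vbar)) :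
    Finite ↥(restrictedSelmerBase ↥((W.baseChange K).endEigenPrimaryTorsion 2 π (1 - r)) 2 v) :=
  (finite_restrictedSelmerBase_conj_iff W K hK hv hvbar hne π hrel r).1 hfinB

/-- The converse direction (hfinB ⟸ hfinB′), for symmetry of the bookkeeping.
[cite: Agboola2007, §6 Prop. 6.10–6.11 (finiteness of the restricted Selmer group over K)] -/
theorem finite_restrictedSelmerBase_of_finite_conj (hK : IsImaginaryQuadratic K) (v vbar : HeightOneSpectrum (𝓞 K))
    (hv : ((2 : ℕ) : 𝓞 K) ∈ v.asIdeal) (hvbar : ((2 : ℕ) : 𝓞 K) ∈ vbar.asIdeal) (hne : vbar ≠ v)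
    (π : (W.baseChange K).endRing) (hrel : (π : AddMonoid.End (W.baseChange K).geomPoints) * π = π - 2) (r : ℤ_[2])
    (hfinB' : Finite ↥(restrictedSelmerBase ↥((W.baseChange K).endEigenPrimaryTorsion 2 π (1 - r)) 2 v)) :
    Finite ↥(restrictedSelmerBase ↥((W.baseChange K).endEigenPrimaryTorsion 2 π r) 2 vbar) :=
  (finite_restrictedSelmerBase_conj_iff W K hK hv hvbar hne π hrel r).2 hfinB'

end Summit.BirchSwinnertonDyer.BirchSwinnertonDyer.Theorems.PrintCf2.ConjTransport

end
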